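import Summits.ResolutionOfSingularities.ResolutionOfSingularities.Theorems.ConeChainAlgebra
import Literature.AlgebraicGeometry.Resolution.WeightedCentreStepUmbrella
import HarnessLib

/-! # ConeChainKernels — decomp-res-lens-4 g42 node «ConeChain», FILE C (§146: LAW B at SCHEME level — the CONE PRESENTATION of the weak
transform at a `τ = 1` near point over a point centre of embedding dimension 3 (`exists_conePresentation_of_stalkTau_eq_one`, from
Literature `IsBlowup.pointStep_trichotomy_of_stalkTau_eq_one` BY NAME), TANGENCY `coneWitness_mem_flagIdealAt`, NO EXCEPTIONAL CONE
`not_coneWitness_of_excIdealAt_eq`; at TOWER level `directrixFlagTower_of_tauOneTower`, `not_exceptionalConeTower_of_tauOneTower`, and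
with LAW τ-chain the two ABSOLUTE `NoTower` kills `noTower_threefold_not_directrixFlag`, `noTower_threefold_exceptionalCone`).
Prepended (still §145, ring level): THE INDEPENDENCE DATUM (critic check c4) `independenceDatum_exceptionalCone` —
in any regular local ring `J′ = (c_jⁿ)` has order `n`, `τ = 1` (`hironakaTauAt_span_pow`, via Literature
`WeightedBlowup.hironakaTau_X_pow`, hence the extra import), `c_j` a cone witness, and NO cone presentation: the configuration LAW B
forbids is consistent with every pre-LAW-B letter.  VERBATIM slice of HOME/decomp-res-lens-4/g42/ConeChain.lean. -/


noncomputable section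

open CategoryTheory AlgebraicGeometry IsLocalRing TopologicalSpace MvPolynomial
open Literature.AlgebraicGeometry.Resolution
open Summit.ResolutionOfSingularities.ResolutionOfSingularities.Theorems
open WeakOrderReduction ForcedTowerClasses DivergentTowerClasses MonomialTowerClasses
open HugDimensionClasses HugDimensionKernels SurfaceShadowClasses SurfaceShadowKernels
open NearPointCut (SingularClass)
open Scheme.IdealSheafData (vanishingIdeal)

universe u

namespace Summit.ResolutionOfSingularities.ResolutionOfSingularities.Theorems.HugValuationCut

/-! ## THE INDEPENDENCE DATUM (c4): `J' = (c_jⁿ)` — τ = 1, cone witness `c_j`, order `n`, and NO cone presentation -/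

section IndependenceDatum

variable {R : Type u} [CommRing R] [IsRegularLocalRing R] {d : ℕ}

/-- The initial forms of the principal ideal `(c_j ^ n)` are the multiples `ā·Y_j^n`. [folklore; Matsumura Thm. 17.10] -/
theorem exists_eq_C_mul_X_pow_of_mem_initialForms_span_pow (hd : (maximalIdeal R).spanFinrank = d) (c : Fin d → R)
    (hc : Ideal.span (Set.range c) = maximalIdeal R) (j : Fin d) (n : ℕ)
    {G : MvPolynomial (Fin d) (ResidueField R)} (hG : G ∈ initialForms c (Ideal.span {c j ^ n}) n) :
    ∃ a : ResidueField R, G = C a * X j ^ n := by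
  obtain ⟨F, hF, hFJ, rfl⟩ := hG
  obtain ⟨r, hr⟩ := Ideal.mem_span_singleton'.1 hFJ
  refine ⟨residue R r, ?_⟩
  have hH : (F - C r * X j ^ n).IsHomogeneous n := by
    refine hF.sub ?_
    simpa using (isHomogeneous_C _ r).mul ((isHomogeneous_X R j).pow n)
  have hres := map_residue_eq_zero_of_eval_mem_pow_succ hd c hc hH
    (by rw [map_sub, map_mul, eval_C, map_pow, eval_X, ← hr, sub_self]; exact Ideal.zero_mem _)
  rwa [map_sub, sub_eq_zero, map_mul, map_C, map_pow, map_X] at hres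

/-- `Y_j^n ∈ cl_n((c_j^n))`. [folklore] -/
theorem X_pow_mem_initialForms_span_pow (c : Fin d → R) (j : Fin d) (n : ℕ) :
    (X j ^ n : MvPolynomial (Fin d) (ResidueField R)) ∈ initialForms c (Ideal.span {c j ^ n}) n :=
  ⟨X j ^ n, by simpa using (isHomogeneous_X R j).pow n, by rw [map_pow, eval_X]; exact Ideal.mem_span_singleton_self _,
    by rw [map_pow, map_X]⟩

/-- **`τ((c_j^n)) = 1`** (`n ≥ 1`): the directrix of `κ·Y_j^n` is the line `κ·Y_j`. [CossartJannsenSaito2020 Def. 1.26; folklore] -/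
theorem hironakaTauAt_span_pow (hd : (maximalIdeal R).spanFinrank = d) (c : Fin d → R)
    (hc : Ideal.span (Set.range c) = maximalIdeal R) (j : Fin d) {n : ℕ} (hn : 1 ≤ n) :
    hironakaTauAt c (Ideal.span {c j ^ n}) n = 1 := by
  have hn0 : n ≠ 0 := by omega
  apply le_antisymm
  · -- `cl_n ⊆ κ[Y_j]`, a subalgebra generated by ONE linear form
    let T' : Submodule (ResidueField R) (Module.Dual (ResidueField R) (Fin d → ResidueField R)) :=
      (ResidueField R) ∙ (LinearMap.proj j)
    have hXj : (X j : MvPolynomial (Fin d) (ResidueField R)) ∈ linearFormsSubalgebra (ResidueField R) T' := by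
      rw [← linearFormPoly_proj (ResidueField R) j]
      exact Algebra.subset_adjoin ⟨_, Submodule.mem_span_singleton_self _, rfl⟩
    have hS : (initialForms c (Ideal.span {c j ^ n}) n : Set (MvPolynomial (Fin d) (ResidueField R))) ⊆
        linearFormsSubalgebra (ResidueField R) T' := by
      intro G hG
      obtain ⟨a, rfl⟩ := exists_eq_C_mul_X_pow_of_mem_initialForms_span_pow hd c hc j n hG
      exact Subalgebra.mul_mem _ (Subalgebra.algebraMap_mem _ a) (Subalgebra.pow_mem _ hXj n)
    refine (hironakaTau_le_finrank_of_subset (ResidueField R) hS).trans ?_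
    exact (finrank_span_le_card _).trans (by simp)
  · -- `κ·Y_j^n ⊆ cl_n`
    have h1 : hironakaTau (ResidueField R) {(X j ^ n : MvPolynomial (Fin d) (ResidueField R))} = 1 :=
      WeightedBlowup.hironakaTau_X_pow j hn0
    have hsub : ({(X j ^ n : MvPolynomial (Fin d) (ResidueField R))} : Set _) ⊆
        (initialForms c (Ideal.span {c j ^ n}) n : Set (MvPolynomial (Fin d) (ResidueField R))) := by
      rintro _ rfl; exact X_pow_mem_initialForms_span_pow c j n
    calc 1 = hironakaTau (ResidueField R) {(X j ^ n : MvPolynomial (Fin d) (ResidueField R))} := h1.symm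
      _ ≤ _ := Submodule.finrank_mono (directrix_mono (ResidueField R) hsub)

/-- **THE INDEPENDENCE DATUM (critic check c4) — the configuration LAW B forbids is CONSISTENT with every letter available BEFORE
LAW B.**  In ANY regular local ring `(R, 𝔫, κ)` with rsop `c`, any index `j` («the exceptional parameter `u = c_j`») and weight `n ≥ 1`,
the ideal `J' := (c_j ^ n)` — «`cl_n(J') = κ·Uⁿ`: the exceptional parameter IS the cone» — satisfies
(i) `J' ≤ 𝔫ⁿ` (order `n`), (ii) `τ(J') = 1` (LAW A / KERNEL B / τ-chain conclusions), (iii) `c_j` is a cone witness of `J'`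
(`c_j ∈ 𝔫 ∖ 𝔫²`, `c_jⁿ ∈ J'` with unit coefficient: the `PlaneConeAt` shape), and nevertheless (iv) `J'` admits NO cone presentation
`a·c_{j₀}ⁿ + c_j·G ∈ J'` (`a` unit, `j₀ ≠ j`) — (iv) is LAW B2 read contrapositively, so the datum is exactly what LAW B excludes for a weak
transform and nothing short of LAW B excludes it. [NEW] -/
theorem independenceDatum_exceptionalCone (hd : (maximalIdeal R).spanFinrank = d) (c : Fin d → R)
    (hc : Ideal.span (Set.range c) = maximalIdeal R) (j : Fin d) {n : ℕ} (hn : 1 ≤ n) :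
    Ideal.span {c j ^ n} ≤ maximalIdeal R ^ n ∧
    hironakaTauAt c (Ideal.span {c j ^ n}) n = 1 ∧
    (c j ∈ maximalIdeal R ∧ c j ∉ maximalIdeal R ^ 2 ∧
      ∃ f ∈ Ideal.span {c j ^ n}, ∃ b : R, IsUnit b ∧ f - b * c j ^ n ∈ maximalIdeal R ^ (n + 1)) ∧
    ¬ ∃ j₀ : Fin d, j ≠ j₀ ∧ ∃ a G : R, IsUnit a ∧ a * c j₀ ^ n + c j * G ∈ Ideal.span {c j ^ n} := by
  have hJ : Ideal.span {c j ^ n} ≤ maximalIdeal R ^ n :=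
    (Ideal.span_singleton_le_iff_mem _).2 (Ideal.pow_mem_pow (rsop_mem c hc j) n)
  have hτ := hironakaTauAt_span_pow hd c hc j hn
  refine ⟨hJ, hτ, ⟨rsop_mem c hc j, rsop_not_mem_sq hd c hc j, c j ^ n, Ideal.mem_span_singleton_self _, 1, isUnit_one,
    by rw [one_mul, sub_self]; exact Ideal.zero_mem _⟩, ?_⟩
  rintro ⟨j₀, hj, a, G, ha, hf⟩
  exact false_of_conePresentation_of_coneWitness_exc hd c hc hn hJ hτ hj ha hf isUnit_one (Ideal.mem_span_singleton_self _)
    (by rw [one_mul, sub_self]; exact Ideal.zero_mem _)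

end IndependenceDatum

/-! ## ══ FILE C `Theorems/ConeChainKernels.lean` (§146; imports FILE B) ══ -/

/-! ## §146 (g42 · NEW · LAW B, SCHEME AND TOWER LEVEL) THE CONE PRESENTATION AT A `τ = 1` NEAR POINT OVER A POINT CENTRE; THE FLAG
PROPAGATES; NO EXCEPTIONAL CONE; THE TWO ABSOLUTE `NoTower` KILLS -/

section SchemeLawB

/-- `Set.range c = {c 0, c 1, c 2}`. [folklore] -/
theorem range_fin_three' {α : Type u} (c : Fin 3 → α) : Set.range c = {c 0, c 1, c 2} := by
  ext s
  simp only [Set.mem_range, Set.mem_insert_iff, Set.mem_singleton_iff]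
  constructor
  · rintro ⟨i, rfl⟩
    fin_cases i
    · exact Or.inl rfl
    · exact Or.inr (Or.inl rfl)
    · exact Or.inr (Or.inr rfl)
  · rintro (h | h | h) <;> exact ⟨_, h.symm⟩

variable {X X' : Scheme.{u}} {π : X' ⟶ X}


set_option maxHeartbeats 800000 in
-- three chart cases of the trichotomy, large stalk terms
/-- **LAW B — THE CONE PRESENTATION AT A `τ = 1` NEAR POINT (scheme level, KERNEL; every characteristic).**  `π` the blowing
up of the closed point `x = π x′` (`𝓘_{Y,x} = 𝔪_x`), `𝒪_x`, `𝒪_{x′}` regular of embedding dimension 3, `ord_x J = μ ≥ 1`,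
`τ(J_x) = 1`, `x′` near.  THEN there are a regular system of parameters `c′` of `𝒪_{x′}` and an index `j ≠ 0` with: `c′_j`
generates the exceptional ideal `𝔪_x 𝒪_{x′}`; `c′_0 = y / c′_j` for a CONE WITNESS `y` of `J_x`; and the weak transform `J′_{x′}`
contains a CONE PRESENTATION `a·c′_0^μ + c′_j·G`, `a` a unit.  BY NAME from the Literature trichotomy
`IsBlowup.pointStep_trichotomy_of_stalkTau_eq_one` (all three chart cases) and the adapted `τ = 1` coordinates.
[CossartPiltant2008 Lemma 4.3 (5), Prop. 4.4 p. 12; CossartJannsenSaito2020 Lemma 14.1; NEW as stated] -/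
theorem exists_conePresentation_of_stalkTau_eq_one [IsLocallyNoetherian X] [IsLocallyNoetherian X']
    {Y : Closeds X} (hπ : IsBlowup π (vanishingIdeal Y)) {J : X.IdealSheafData} {μ : ℕ} (hμ : 1 ≤ μ)
    {x' : X'} [IsRegularLocalRing (X.presheaf.stalk (π x'))] [IsRegularLocalRing (X'.presheaf.stalk x')]
    (hd : (maximalIdeal (X.presheaf.stalk (π x'))).spanFinrank = 3)
    (hd' : (maximalIdeal (X'.presheaf.stalk x')).spanFinrank = 3)
    (hY : stalkIdeal (vanishingIdeal Y) (π x') = maximalIdeal _)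
    (hord : idealOrder J (π x') = ((μ : ℕ) : ℕ∞)) (hτ : stalkTau J (π x') μ = 1)
    (hnear : IsNear π (vanishingIdeal Y) J μ x') :
    ∃ (c' : Fin 3 → X'.presheaf.stalk x') (j : Fin 3), j ≠ 0 ∧
      Ideal.span (Set.range c') = maximalIdeal _ ∧
      (maximalIdeal (X.presheaf.stalk (π x'))).map (π.stalkMap x').hom = Ideal.span {c' j} ∧
      (∃ y : X.presheaf.stalk (π x'), ConeWitness J μ (π x') y ∧ (π.stalkMap x').hom y = c' j * c' 0) ∧
      ∃ a G : X'.presheaf.stalk x', IsUnit a ∧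
        a * c' 0 ^ μ + c' j * G ∈ stalkIdeal (controlledTransform π (vanishingIdeal Y) J μ) x' := by
  classical
  -- (1) adapted coordinates at `x` and the cone witness `c 0` (the §94 computation)
  have hle : stalkIdeal J (π x') ≤ maximalIdeal _ ^ μ := (le_idealOrder_iff J (π x') μ).mp hord.ge
  have hnle : ¬ stalkIdeal J (π x') ≤ maximalIdeal _ ^ (μ + 1) := by
    rw [← le_idealOrder_iff, hord]
    exact_mod_cast Nat.not_succ_le_self μ
  obtain ⟨f, hfJ, hfn⟩ : ∃ f ∈ stalkIdeal J (π x'), f ∉ maximalIdeal _ ^ (μ + 1) := by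
    by_contra h
    push Not at h
    exact hnle fun f hf => h f hf
  obtain ⟨c, hc, had⟩ := exists_rsop_forall_ne_zero_isAdapted_of_stalkTau_eq_one J (π x') hd hτ
  have hτc : hironakaTauAt c (stalkIdeal J (π x')) μ = 1 := by rw [← stalkTau_eq J (π x') μ hd c hc]; exact hτ
  obtain ⟨F, hF, hFf⟩ := exists_isHomogeneous_eval_eq_of_mem_pow c hc (hle hfJ)
  have hG : MvPolynomial.map (residue _) F ∈ initialForms c (stalkIdeal J (π x')) μ :=
    ⟨F, hF, by rw [hFf]; exact hfJ, rfl⟩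
  obtain ⟨a, ha⟩ := forall_initialForms_eq_C_mul_X_pow_of_isAdapted c hτc had _ hG
  obtain ⟨a', rfl⟩ := residue_surjective a
  have hF' : (F - C a' * MvPolynomial.X (0 : Fin 3) ^ μ).IsHomogeneous μ := hF.sub (isHomogeneous_C_mul_X_pow a' 0 μ)
  have hres : MvPolynomial.map (residue _) (F - C a' * MvPolynomial.X (0 : Fin 3) ^ μ) = 0 := by
    rw [map_sub, ha, map_mul, map_C, map_pow, map_X, sub_self]
  have hdiff : f - a' * c 0 ^ μ ∈ maximalIdeal (X.presheaf.stalk (π x')) ^ (μ + 1) := by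
    have h := eval_mem_pow_succ_of_map_residue_eq_zero c hc hF' hres
    rwa [map_sub, hFf, map_mul, eval_C, map_pow, eval_X] at h
  have hc0 : c 0 ∈ maximalIdeal (X.presheaf.stalk (π x')) := rsop_mem c hc 0
  have ha' : IsUnit a' := by
    by_contra hna
    have hmem : a' * c 0 ^ μ ∈ maximalIdeal (X.presheaf.stalk (π x')) ^ (μ + 1) := by
      rw [pow_succ']
      exact Ideal.mul_mem_mul ((mem_maximalIdeal _).mpr hna) (Ideal.pow_mem_pow hc0 μ)
    exact hfn (by simpa using (Ideal.add_mem _ hdiff hmem))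
  have hcw : ConeWitness J μ (π x') (c 0) := ⟨hc0, rsop_not_mem_sq hd c hc 0, f, hfJ, a', ha', hdiff⟩
  -- (2) the trichotomy, read uniformly
  have hcY : Ideal.span (Set.range c) = stalkIdeal (vanishingIdeal Y) (π x') := hc.trans hY.symm
  obtain ⟨j, c', hj0, hc', hci, hcj, h0, hcolon⟩ : ∃ (j : Fin 3) (c' : Fin 3 → X'.presheaf.stalk x'), j ≠ 0 ∧
      Ideal.span (Set.range c') = maximalIdeal _ ∧ (∀ i, (π.stalkMap x').hom (c i) ∈ Ideal.span {c' j}) ∧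
      c' j = (π.stalkMap x').hom (c j) ∧ (π.stalkMap x').hom (c 0) = c' j * c' 0 ∧
      stalkIdeal (controlledTransform π (vanishingIdeal Y) J μ) x' =
        Submodule.colon ((stalkIdeal J (π x')).map (π.stalkMap x').hom) ({c' j ^ μ} : Set (X'.presheaf.stalk x')) := by
    rcases hπ.pointStep_trichotomy_of_stalkTau_eq_one hμ hd hd' hc hcY hτ had hnear with
      ⟨a, c', h1, h0, h2, hspan, -, hcolon⟩ | ⟨t, P, c', h1, h0, h2, -, -, -, -, -, hspan, hcolon⟩ |
      ⟨c', h2, h0, h1, hspan, -, hcolon⟩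
    · refine ⟨1, c', by decide, by rw [range_fin_three', hspan], ?_, h1, by rw [h0, h1], by rw [h1]; exact hcolon⟩
      intro i
      fin_cases i
      · exact Ideal.mem_span_singleton'.mpr ⟨c' 0, by simp only [Fin.zero_eta]; rw [h0, h1, mul_comm]⟩
      · simp only [Fin.mk_one]; rw [← h1]; exact Ideal.mem_span_singleton_self _
      · refine Ideal.mem_span_singleton'.mpr ⟨c' 2 + (π.stalkMap x').hom a, ?_⟩
        have h := h2
        rw [map_sub, map_mul, sub_eq_iff_eq_add] at h
        simp only [Fin.reduceFinMk]
        rw [h, ← h1]; ring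
    · refine ⟨1, c', by decide, by rw [range_fin_three', hspan], ?_, h1, by rw [h0, h1], by rw [h1]; exact hcolon⟩
      intro i
      fin_cases i
      · exact Ideal.mem_span_singleton'.mpr ⟨c' 0, by simp only [Fin.zero_eta]; rw [h0, h1, mul_comm]⟩
      · simp only [Fin.mk_one]; rw [← h1]; exact Ideal.mem_span_singleton_self _
      · exact Ideal.mem_span_singleton'.mpr ⟨t, by simp only [Fin.reduceFinMk]; rw [h2, h1, mul_comm]⟩
    · refine ⟨2, c', by decide, by rw [range_fin_three', hspan], ?_, h2, by rw [h0, h2], by rw [h2]; exact hcolon⟩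
      intro i
      fin_cases i
      · exact Ideal.mem_span_singleton'.mpr ⟨c' 0, by simp only [Fin.zero_eta]; rw [h0, h2, mul_comm]⟩
      · exact Ideal.mem_span_singleton'.mpr ⟨c' 1, by simp only [Fin.mk_one]; rw [h1, h2, mul_comm]⟩
      · simp only [Fin.reduceFinMk]; rw [← h2]; exact Ideal.mem_span_singleton_self _
  -- (3) the exceptional ideal `𝔪_x 𝒪_{x′} = (c′_j)`
  have hexc : (maximalIdeal (X.presheaf.stalk (π x'))).map (π.stalkMap x').hom = Ideal.span {c' j} := by
    refine le_antisymm ?_ ?_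
    · rw [← hc, Ideal.map_span, Ideal.span_le]
      rintro _ ⟨_, ⟨i, rfl⟩, rfl⟩
      exact hci i
    · rw [Ideal.span_singleton_le_iff_mem, hcj]
      exact Ideal.mem_map_of_mem _ (rsop_mem c hc j)
  -- (4) the cone presentation `φ(a)·c′_0^μ + c′_j·r′ ∈ J′_{x′}`
  have hr : (π.stalkMap x').hom (f - a' * c 0 ^ μ) ∈ Ideal.span {c' j ^ (μ + 1)} := by
    rw [← Ideal.span_singleton_pow, ← hexc, ← Ideal.map_pow]
    exact Ideal.mem_map_of_mem _ hdiff
  obtain ⟨r', hr'⟩ := Ideal.mem_span_singleton'.mp hr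
  refine ⟨c', j, hj0, hc', hexc, ⟨c 0, hcw, h0⟩, (π.stalkMap x').hom a', r', ha'.map _, ?_⟩
  rw [hcolon, Submodule.mem_colon]
  rintro _ rfl
  rw [smul_eq_mul]
  have hφf : (π.stalkMap x').hom f = (π.stalkMap x').hom a' * (c' j * c' 0) ^ μ + r' * c' j ^ (μ + 1) := by
    rw [hr', ← h0, ← map_pow, ← map_mul, ← map_add, add_sub_cancel]
  have : ((π.stalkMap x').hom a' * c' 0 ^ μ + c' j * r') * c' j ^ μ = (π.stalkMap x').hom f := by
    rw [hφf]; ring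
  rw [this]
  exact Ideal.mem_map_of_mem _ hfJ

/-- **LAW B1 (scheme level) — TANGENCY: every cone witness of the weak transform at a `τ = 1` near point lies in the FLAG IDEAL**
(`τ(x′) = 1` as hypothesis; on a threefold forced tower it is LAW τ-chain). [NEW] -/
theorem coneWitness_mem_flagIdealAt [IsLocallyNoetherian X] [IsLocallyNoetherian X']
    {Y : Closeds X} (hπ : IsBlowup π (vanishingIdeal Y)) {J : X.IdealSheafData} {μ : ℕ} (hμ : 1 ≤ μ)
    {x' : X'} [IsRegularLocalRing (X.presheaf.stalk (π x'))] [IsRegularLocalRing (X'.presheaf.stalk x')]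
    (hd : (maximalIdeal (X.presheaf.stalk (π x'))).spanFinrank = 3)
    (hd' : (maximalIdeal (X'.presheaf.stalk x')).spanFinrank = 3)
    (hY : stalkIdeal (vanishingIdeal Y) (π x') = maximalIdeal _)
    (hord : idealOrder J (π x') = ((μ : ℕ) : ℕ∞)) (hτ : stalkTau J (π x') μ = 1)
    (hnear : IsNear π (vanishingIdeal Y) J μ x')
    (hτ' : stalkTau (controlledTransform π (vanishingIdeal Y) J μ) x' μ = 1)
    {z : X'.presheaf.stalk x'} (hz : ConeWitness (controlledTransform π (vanishingIdeal Y) J μ) μ x' z) :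
    z ∈ flagIdealAt π J μ x' := by
  obtain ⟨c', j, hj0, hc', hexc, ⟨y, hy, hyφ⟩, a, G, ha, hf⟩ :=
    exists_conePresentation_of_stalkTau_eq_one hπ hμ hd hd' hY hord hτ hnear
  have hJ' : stalkIdeal (controlledTransform π (vanishingIdeal Y) J μ) x' ≤ maximalIdeal _ ^ μ :=
    (le_idealOrder_iff _ x' μ).mp (isNear_iff.mp hnear).ge
  have hτc : hironakaTauAt c' (stalkIdeal (controlledTransform π (vanishingIdeal Y) J μ) x') μ = 1 := by
    rw [← stalkTau_eq _ x' μ hd' c' hc']; exact hτ'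
  obtain ⟨hzm, -, g, hg, b, hb, hgz⟩ := hz
  have hmem := mem_span_pair_sup_sq_of_conePresentation hd' c' hc' hμ hJ' hτc hj0 ha hf hzm hb hg hgz
  have hle : Ideal.span {c' 0, c' j} ≤ excIdealAt π x' ⊔
      Ideal.span {w | ∃ (y : X.presheaf.stalk (π x')) (u : X'.presheaf.stalk x'), ConeWitness J μ (π x') y ∧
        excIdealAt π x' = Ideal.span {u} ∧ (π.stalkMap x').hom y = u * w} := by
    rw [Ideal.span_le]
    rintro w (rfl | rfl)
    · exact Ideal.mem_sup_right (Ideal.subset_span ⟨y, c' j, hy, hexc, hyφ⟩)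
    · refine Ideal.mem_sup_left ?_
      change c' j ∈ (maximalIdeal (X.presheaf.stalk (π x'))).map (π.stalkMap x').hom
      rw [hexc]
      exact Ideal.mem_span_singleton_self _
  exact (sup_le_sup_right hle _) hmem

/-- **LAW B2 (scheme level) — NO EXCEPTIONAL CONE: at a `τ = 1` near point a generator of the exceptional ideal is never a cone
witness of the weak transform.** [NEW] -/
theorem not_coneWitness_of_excIdealAt_eq [IsLocallyNoetherian X] [IsLocallyNoetherian X']
    {Y : Closeds X} (hπ : IsBlowup π (vanishingIdeal Y)) {J : X.IdealSheafData} {μ : ℕ} (hμ : 1 ≤ μ)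
    {x' : X'} [IsRegularLocalRing (X.presheaf.stalk (π x'))] [IsRegularLocalRing (X'.presheaf.stalk x')]
    (hd : (maximalIdeal (X.presheaf.stalk (π x'))).spanFinrank = 3)
    (hd' : (maximalIdeal (X'.presheaf.stalk x')).spanFinrank = 3)
    (hY : stalkIdeal (vanishingIdeal Y) (π x') = maximalIdeal _)
    (hord : idealOrder J (π x') = ((μ : ℕ) : ℕ∞)) (hτ : stalkTau J (π x') μ = 1)
    (hnear : IsNear π (vanishingIdeal Y) J μ x')
    (hτ' : stalkTau (controlledTransform π (vanishingIdeal Y) J μ) x' μ = 1)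
    {u : X'.presheaf.stalk x'} (hu : excIdealAt π x' = Ideal.span {u}) :
    ¬ ConeWitness (controlledTransform π (vanishingIdeal Y) J μ) μ x' u := by
  classical
  rintro ⟨-, -, g, hg, b, hb, hgb⟩
  obtain ⟨c', j, hj0, hc', hexc, -, a, G, ha, hf⟩ :=
    exists_conePresentation_of_stalkTau_eq_one hπ hμ hd hd' hY hord hτ hnear
  have hJ' : stalkIdeal (controlledTransform π (vanishingIdeal Y) J μ) x' ≤ maximalIdeal _ ^ μ :=
    (le_idealOrder_iff _ x' μ).mp (isNear_iff.mp hnear).ge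
  have hτc : hironakaTauAt c' (stalkIdeal (controlledTransform π (vanishingIdeal Y) J μ) x') μ = 1 := by
    rw [← stalkTau_eq _ x' μ hd' c' hc']; exact hτ'
  haveI := isDomain_of_isRegularLocalRing (X'.presheaf.stalk x')
  have hexc' : excIdealAt π x' = Ideal.span {c' j} := hexc
  obtain ⟨v, hv⟩ := Ideal.span_singleton_eq_span_singleton.mp (hu.symm.trans hexc')
  have hu' : u = c' j * ↑v⁻¹ := by rw [← hv, mul_assoc, Units.mul_inv, mul_one]
  refine false_of_conePresentation_of_coneWitness_exc hd' c' hc' hμ hJ' hτc hj0 ha hf (g := g) (b := b * ↑v⁻¹ ^ μ)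
    (hb.mul ((Units.isUnit _).pow _)) hg ?_
  · have : b * u ^ μ = b * ↑v⁻¹ ^ μ * c' j ^ μ := by rw [hu']; ring
    rwa [← this]

end SchemeLawB

section TowerLawB

variable {k : Type} [Field k]

/-- the stage data of a threefold forced tower at `x_{i+1}` over `π_i(x_{i+1})`, packaged for the scheme law. [folklore] -/
theorem tower_stage_data (T : ForcedTower) (g : T.St 0 ⟶ Spec (.of k)) (hB : IsBase (T.St 0) g) {n : ℕ}
    (hD : IsDatum n (T.D 0)) (h3 : ThreefoldTower T) (hτ : TauOneTower n T) (i : ℕ) :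
    ∃ (_ : IsLocallyNoetherian (T.St i)) (_ : IsLocallyNoetherian (T.St (i + 1)))
      (_ : IsRegularLocalRing ((T.St i).presheaf.stalk ((T.π i).base (T.pt (i + 1)))))
      (_ : IsRegularLocalRing ((T.St (i + 1)).presheaf.stalk (T.pt (i + 1)))),
      (maximalIdeal ((T.St i).presheaf.stalk ((T.π i).base (T.pt (i + 1))))).spanFinrank = 3 ∧
      (maximalIdeal ((T.St (i + 1)).presheaf.stalk (T.pt (i + 1)))).spanFinrank = 3 ∧
      stalkIdeal (vanishingIdeal ⟨{(T.π i).base (T.pt (i + 1))}, tower_isClosed_base T i⟩) ((T.π i).base (T.pt (i + 1))) =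
        maximalIdeal _ ∧
      idealOrder (T.D i).ideal ((T.π i).base (T.pt (i + 1))) = ((n : ℕ) : ℕ∞) ∧
      stalkTau (T.D i).ideal ((T.π i).base (T.pt (i + 1))) n = 1 ∧
      stalkTau (controlledTransform (T.π i) (vanishingIdeal ⟨{(T.π i).base (T.pt (i + 1))}, tower_isClosed_base T i⟩)
        (T.D i).ideal n) (T.pt (i + 1)) n = 1 := by
  have hNR := tower_isLocallyNoetherian_isRegular T g hB
  haveI : IsLocallyNoetherian (T.St i) := (hNR i).1
  haveI : IsLocallyNoetherian (T.St (i + 1)) := (hNR (i + 1)).1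
  haveI := tower_isRegular T g hB i ((T.π i).base (T.pt (i + 1)))
  haveI := tower_isRegular T g hB (i + 1) (T.pt (i + 1))
  have hd := tower_spanFinrank_eq_three_base T g hB h3 i
  obtain ⟨c₀, hc₀, hc₀Y⟩ := CampaignW46.exists_rsop_three (tower_isClosed_base T i) hd
  have hord : idealOrder (T.D i).ideal ((T.π i).base (T.pt (i + 1))) = ((n : ℕ) : ℕ∞) := by
    have key : ∀ x, x = T.pt i → idealOrder (T.D i).ideal x = ((n : ℕ) : ℕ∞) := by
      rintro x rfl; exact tower_idealOrder_pt_eq T g hB hD i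
    exact key _ (T.pt_map i)
  have hτi : stalkTau (T.D i).ideal ((T.π i).base (T.pt (i + 1))) n = 1 := by
    have key : ∀ (x : T.St i), x = T.pt i → ∀ (h : IsRegularLocalRing ((T.St i).presheaf.stalk x)),
        @stalkTau (T.St i) (T.D i).ideal x h n = 1 := by
      rintro x rfl h; exact hτ i h
    exact key _ (T.pt_map i) _
  have hτ' : stalkTau (controlledTransform (T.π i)
      (vanishingIdeal ⟨{(T.π i).base (T.pt (i + 1))}, tower_isClosed_base T i⟩) (T.D i).ideal n) (T.pt (i + 1)) n = 1 := by
    rw [← tower_ideal_succ_eq_controlledTransform_base T hD i]; exact hτ (i + 1) _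
  exact ⟨inferInstance, inferInstance, inferInstance, inferInstance, hd, tower_spanFinrank_eq_three T g hB h3 (i + 1),
    hc₀Y.symm.trans hc₀, hord, hτi, hτ'⟩

/-- **TOWER LAW B1 — THE DIRECTRIX FLAG PROPAGATES (KERNEL, PROVED; every `p`, field, class; weight `n ≥ 1`)**: a threefold forced
tower with `τ = 1` at every marked point (which is EVERY threefold forced tower, LAW τ-chain) is a directrix-flag tower. [NEW] -/
theorem directrixFlagTower_of_tauOneTower (T : ForcedTower) (g : T.St 0 ⟶ Spec (.of k)) (hB : IsBase (T.St 0) g) {n : ℕ}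
    (hn : 1 ≤ n) (hD : IsDatum n (T.D 0)) (h3 : ThreefoldTower T) (hτ : TauOneTower n T) : DirectrixFlagTower n T := by
  intro i z hz
  obtain ⟨_, _, _, _, hd, hd', hY, hord, hτi, hτ'⟩ := tower_stage_data T g hB hD h3 hτ i
  have hz' : ConeWitness (controlledTransform (T.π i)
      (vanishingIdeal ⟨{(T.π i).base (T.pt (i + 1))}, tower_isClosed_base T i⟩) (T.D i).ideal n) n (T.pt (i + 1)) z := by
    rw [← tower_ideal_succ_eq_controlledTransform_base T hD i]; exact hz
  exact coneWitness_mem_flagIdealAt (tower_isBlowup_base T i) hn hd hd' hY hord hτi (tower_isNear_base T g hB hD i) hτ' hz'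

/-- **TOWER LAW B2 — NO EXCEPTIONAL CONE (KERNEL, PROVED)**: a threefold forced tower with `τ = 1` at every marked point has no
exceptional-cone stage. [NEW] -/
theorem not_exceptionalConeTower_of_tauOneTower (T : ForcedTower) (g : T.St 0 ⟶ Spec (.of k)) (hB : IsBase (T.St 0) g)
    {n : ℕ} (hn : 1 ≤ n) (hD : IsDatum n (T.D 0)) (h3 : ThreefoldTower T) (hτ : TauOneTower n T) :
    ¬ ExceptionalConeTower n T := by
  rintro ⟨i, u, hu, hcw⟩
  obtain ⟨_, _, _, _, hd, hd', hY, hord, hτi, hτ'⟩ := tower_stage_data T g hB hD h3 hτ i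
  have hcw' : ConeWitness (controlledTransform (T.π i)
      (vanishingIdeal ⟨{(T.π i).base (T.pt (i + 1))}, tower_isClosed_base T i⟩) (T.D i).ideal n) n (T.pt (i + 1)) u := by
    rw [← tower_ideal_succ_eq_controlledTransform_base T hD i]; exact hcw
  exact not_coneWitness_of_excIdealAt_eq (tower_isBlowup_base T i) hn hd hd' hY hord hτi (tower_isNear_base T g hB hD i)
    hτ' hu hcw'

/-- **THE KILL OF THE TRANSVERSAL-CONE SIDE — ABSOLUTE (every `p`, field, class `P`, weight `n ≥ 1`; no `MinimalAt`, no ports)**: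
«threefold ∧ ¬(DF)» is EMPTY: LAW B1 if `τ ≡ 1`, LAW τ-chain otherwise. [NEW] -/
theorem noTower_threefold_not_directrixFlag {n : ℕ} (hn : 1 ≤ n) (P : ForcedTower → Prop) :
    NoTower n fun T => P T ∧ ThreefoldTower T ∧ ¬ DirectrixFlagTower n T := by
  intro p hp K _ _ T g hB hD hE hT
  obtain ⟨hP, h3, hDF⟩ := hT
  by_cases hτ : TauOneTower n T
  · exact hDF (directrixFlagTower_of_tauOneTower T g hB hn hD h3 hτ)
  · exact noTower_threefold_not_tauOne hn P p hp K T g hB hD hE ⟨hP, h3, hτ⟩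

/-- **THE KILL OF THE EXCEPTIONAL-CONE SIDE — ABSOLUTE**: «threefold ∧ (EC)» is EMPTY: LAW B2 if `τ ≡ 1`, LAW τ-chain otherwise.
[NEW] -/
theorem noTower_threefold_exceptionalCone {n : ℕ} (hn : 1 ≤ n) (P : ForcedTower → Prop) :
    NoTower n fun T => P T ∧ ThreefoldTower T ∧ ExceptionalConeTower n T := by
  intro p hp K _ _ T g hB hD hE hT
  obtain ⟨hP, h3, hEC⟩ := hT
  by_cases hτ : TauOneTower n T
  · exact not_exceptionalConeTower_of_tauOneTower T g hB hn hD h3 hτ hEC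
  · exact noTower_threefold_not_tauOne hn P p hp K T g hB hD hE ⟨hP, h3, hτ⟩

end TowerLawB

end Summit.ResolutionOfSingularities.ResolutionOfSingularities.Theorems.HugValuationCut
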